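import Summits.QuantumFields.YangMills.Theorems.LangevinControlUVOSLegsAtWeakCouplingCStubLocalityOneSlot
import Summits.QuantumFields.YangMills.Theorems.LangevinControlUVOSLegsAtWeakCouplingCStubLocalityBumps
import Literature.MathematicalPhysics.QuantumLattice.SchwingerOSCluster
import Mathlib.MeasureTheory.Integral.Pi
import HarnessLib

/-!
# Density bounds for product bumps and their OS field vectors (E1-locality — file C1)

Helper file for stub `stub_locality` of crux `OSLegsAtWeakCouplingC` (stmt-QuantumFields-16207, line `Sketch`,
continuation lead c2).  The Osterwalder–Schrader sector engine needs bounds on the slot functions; with bounded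
densities off the diagonal (`OffDiagDensity`, the landed `stub_density`) these bounds are UNIFORM in the centres:

* `hasCompactSupport_prodBumps`, `tsupport_prodBumps_subset_separated`, `integral_norm_prodBumps`
  (`∫|⊗ρ(· − cᵢ)| = (∫|ρ|)ⁿ`), whence `norm_apply_prodBumps_le`: `|S₁ n (⊗ρ(· − cᵢ))| ≤ B (∫|ρ|)ⁿ` for centres
  pairwise `≥ δ + 2r` apart;
* `osAdjoint_prodBumps_appendTensor_self`: the OS self-pairing `ΘF* ⊗ F` of a product bump is the product bump over
  the reflected-reversed centres followed by the centres, so (`sep_append_reflect`, `norm_fieldVec_prodBumps_le`)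
  the OS field vector of a separated positive-time product bump has norm `≤ (B (∫|ρ|)^{2n})^{1/2}`.
-/

set_option autoImplicit false

noncomputable section

namespace Summit.QuantumFields.YangMills.Theorems.OSLegsAtWeakCouplingC.Loc

open scoped ComplexConjugate SchwartzMap InnerProductSpace
open MeasureTheory
open Literature.MathematicalPhysics.QuantumLattice Literature.MathematicalPhysics.AQFT
open Literature.MathematicalPhysics.QuantumFieldTheory
open Literature.MathematicalPhysics.QuantumLattice.SchwingerFamily (timeVec)
open Summit.QuantumFields.YangMills.Cruxes.OSLegsAtWeakCouplingC.Sketch (OffDiagDensity Separated)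

variable {n : ℕ} {ρ : 𝓢(EuclideanSpace ℝ (Fin 4), ℂ)} {r : ℝ}

/-! ### Support and mass of a product bump -/

/-- A product bump of a compactly supported profile is compactly supported. -/
theorem hasCompactSupport_prodBumps (hρ : tsupport (ρ : EuclideanSpace ℝ (Fin 4) → ℂ) ⊆ Metric.closedBall 0 r)
    (c : Fin n → EuclideanSpace ℝ (Fin 4)) :
    HasCompactSupport (prodBumps ρ n c : (Fin n → EuclideanSpace ℝ (Fin 4)) → ℂ) := by
  refine IsCompact.of_isClosed_subset ?_ (isClosed_tsupport _) (tsupport_prodBumps_subset ρ hρ c)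
  have : {x : Fin n → EuclideanSpace ℝ (Fin 4) | ∀ i, x i ∈ Metric.closedBall (c i) r} =
      Set.pi Set.univ fun i => Metric.closedBall (c i) r := by
    ext x; simp
  rw [this]
  exact isCompact_univ_pi fun i => isCompact_closedBall _ _

/-- **Separated centres give separated supports**: if the centres are pairwise `≥ δ + 2r` apart, the product bump is
supported in `Separated n δ`. -/
theorem tsupport_prodBumps_subset_separated (hρ : tsupport (ρ : EuclideanSpace ℝ (Fin 4) → ℂ) ⊆ Metric.closedBall 0 r)
    {δ : ℝ} {c : Fin n → EuclideanSpace ℝ (Fin 4)} (hc : ∀ i j, i ≠ j → δ + 2 * r ≤ dist (c i) (c j)) :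
    tsupport (prodBumps ρ n c : (Fin n → EuclideanSpace ℝ (Fin 4)) → ℂ) ⊆ Separated n δ := by
  intro x hx i j hij
  have h := tsupport_prodBumps_subset ρ hρ c hx
  have hi := Metric.mem_closedBall.1 (h i)
  have hj := Metric.mem_closedBall.1 (h j)
  have h1 := dist_triangle (c i) (x i) (x j)
  have h2 := dist_triangle (c i) (x j) (c j)
  rw [dist_comm] at hi
  linarith [hc i j hij]

/-- **The `L¹` mass of a product bump** is the `n`-th power of the mass of the profile. -/
theorem integral_norm_prodBumps (c : Fin n → EuclideanSpace ℝ (Fin 4)) :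
    ∫ x, ‖prodBumps ρ n c x‖ = (∫ y, ‖ρ y‖) ^ n := by
  simp_rw [prodBumps_apply, norm_prod]
  rw [integral_fintype_prod_volume_eq_prod (f := fun i (y : EuclideanSpace ℝ (Fin 4)) => ‖ρ (y - c i)‖)]
  have h : ∀ i, ∫ y, ‖ρ (y - c i)‖ = ∫ y, ‖ρ y‖ := fun i =>
    integral_sub_right_eq_self (fun y => ‖ρ y‖) (c i)
  simp_rw [h]
  rw [Finset.prod_const, Finset.card_univ, Fintype.card_fin]

/-! ### Density bounds on product bumps -/

variable {S₁ : SchwingerFamily (EuclideanSpace ℝ (Fin 4))}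

/-- **Uniform bound on separated product bumps** from bounded densities off the diagonal: with `B` the density
constant of `S₁ n` at distance `δ`, `|S₁ n (⊗ ρ(· − cᵢ))| ≤ B (∫|ρ|)ⁿ` whenever the centres are `≥ δ + 2r` apart. -/
theorem norm_apply_prodBumps_le (hρ : tsupport (ρ : EuclideanSpace ℝ (Fin 4) → ℂ) ⊆ Metric.closedBall 0 r)
    {δ B : ℝ} (hB : ∀ F : 𝓢((Fin n → EuclideanSpace ℝ (Fin 4)), ℂ),
      HasCompactSupport (F : (Fin n → EuclideanSpace ℝ (Fin 4)) → ℂ) →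
      tsupport (F : (Fin n → EuclideanSpace ℝ (Fin 4)) → ℂ) ⊆ Separated n δ → ‖S₁ n F‖ ≤ B * ∫ x, ‖F x‖)
    {c : Fin n → EuclideanSpace ℝ (Fin 4)} (hc : ∀ i j, i ≠ j → δ + 2 * r ≤ dist (c i) (c j)) :
    ‖S₁ n (prodBumps ρ n c)‖ ≤ B * (∫ y, ‖ρ y‖) ^ n := by
  rw [← integral_norm_prodBumps c]
  exact hB _ (hasCompactSupport_prodBumps hρ c) (tsupport_prodBumps_subset_separated hρ hc)

/-- **The OS self-pairing of a product bump is a product bump** over the reflected-reversed centres followed by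
the centres (real profile invariant under the time reflection). -/
theorem osAdjoint_prodBumps_appendTensor_self
    (hρθ : ∀ x, ρ (timeReflection 4 x) = ρ x)
    (hρre : ∀ x, conj (ρ x) = ρ x) (c : Fin n → EuclideanSpace ℝ (Fin 4)) :
    (osAdjoint (prodBumps ρ n c)).appendTensor (prodBumps ρ n c) =
      prodBumps ρ (n + n) (Fin.append (fun p => timeReflection 4 (c (Fin.rev p))) c) := by
  have h := osAdjoint_prodBumps_appendTensor ρ hρθ hρre
    (fun p => timeReflection 4 (c (Fin.rev p))) c 0
  have h1 : (fun j : Fin n => timeReflection 4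
      ((fun p => timeReflection 4 (c (Fin.rev p))) (Fin.rev j))) = c := by
    funext j
    simp [timeReflection_timeReflection, Fin.rev_rev]
  have h2 : (fun j : Fin n => c j + (timeVec 0 : EuclideanSpace ℝ (Fin 4))) = c := by
    funext j; simp [timeVec]
  rw [h1, h2, SchwingerFamily.timeVec_zero,
    translateMulti_zero] at h
  exact h

/-- Separation of the reflected-reversed centres followed by the centres: if the centres have times `≥ η`, are
pairwise `≥ 2η` apart, then all points of the appended configuration are pairwise `≥ 2η` apart. -/
theorem sep_append_reflect {η : ℝ} (hη0 : 0 ≤ η) {c : Fin n → EuclideanSpace ℝ (Fin 4)} (h0 : ∀ p, η ≤ c p 0)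
    (hsep : ∀ p p', p ≠ p' → 2 * η ≤ dist (c p) (c p')) :
    ∀ i j : Fin (n + n), i ≠ j →
      2 * η ≤ dist (Fin.append (fun p => timeReflection 4 (c (Fin.rev p))) c i)
        (Fin.append (fun p => timeReflection 4 (c (Fin.rev p))) c j) := by
  intro i j hij
  induction i using Fin.addCases with
  | left p =>
    induction j using Fin.addCases with
    | left p' =>
      rw [Fin.append_left, Fin.append_left, LinearIsometryEquiv.dist_map]
      exact hsep _ _ (fun h => hij (by rw [Fin.rev_inj.1 h]))
    | right p' =>
      rw [Fin.append_left, Fin.append_right]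
      have h := abs_apply_zero_sub_le (timeReflection 4 (c (Fin.rev p))) (c p')
      rw [timeReflection_apply, if_pos rfl] at h
      have h1 := h0 (Fin.rev p); have h2 := h0 p'
      have : 2 * η ≤ |-(c (Fin.rev p)) 0 - (c p') 0| := by
        rw [abs_of_nonpos (by linarith)]; linarith
      exact this.trans h
  | right p =>
    induction j using Fin.addCases with
    | left p' =>
      rw [Fin.append_left, Fin.append_right]
      have h := abs_apply_zero_sub_le (c p) (timeReflection 4 (c (Fin.rev p')))
      rw [timeReflection_apply, if_pos rfl] at h
      have h1 := h0 (Fin.rev p'); have h2 := h0 p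
      have : 2 * η ≤ |(c p) 0 - -(c (Fin.rev p')) 0| := by
        rw [abs_of_nonneg (by linarith)]; linarith
      exact this.trans h
    | right p' =>
      rw [Fin.append_right, Fin.append_right]
      exact hsep _ _ (fun h => hij (by rw [h]))

/-- **Uniform bound on the OS field vectors of separated positive-time product bumps**: if the centres have
times `≥ η` with `δ + 2r ≤ 2η` and are pairwise `≥ 2η` apart, then `‖Ψ_F‖ ≤ (B (∫|ρ|)^{2n})^{1/2}` with `B`
the density constant of `S₁ (n+n)` at distance `δ`. -/
theorem norm_fieldVec_prodBumps_le (h : OSReconstructionNoE1 S₁.toLabelled)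
    (hρ : tsupport (ρ : EuclideanSpace ℝ (Fin 4) → ℂ) ⊆ Metric.closedBall 0 r)
    (hρθ : ∀ x, ρ (timeReflection 4 x) = ρ x)
    (hρre : ∀ x, conj (ρ x) = ρ x)
    {δ B : ℝ} (hB : ∀ F : 𝓢((Fin (n + n) → EuclideanSpace ℝ (Fin 4)), ℂ),
      HasCompactSupport (F : (Fin (n + n) → EuclideanSpace ℝ (Fin 4)) → ℂ) →
      tsupport (F : (Fin (n + n) → EuclideanSpace ℝ (Fin 4)) → ℂ) ⊆ Separated (n + n) δ → ‖S₁ (n + n) F‖ ≤ B * ∫ x, ‖F x‖)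
    {η : ℝ} (hη0 : 0 ≤ η) (hη : δ + 2 * r ≤ 2 * η) {c : Fin n → EuclideanSpace ℝ (Fin 4)} (h0 : ∀ p, η ≤ c p 0)
    (hsep : ∀ p p', p ≠ p' → 2 * η ≤ dist (c p) (c p')) (hF : IsTimeOrdered (prodBumps ρ n c)) :
    ‖h.fieldVec n (fun _ => ()) (prodBumps ρ n c) hF‖ ≤ Real.sqrt (B * (∫ y, ‖ρ y‖) ^ (n + n)) := by
  refine (norm_fieldVec_le h hF).trans (Real.sqrt_le_sqrt ?_)
  rw [osAdjoint_prodBumps_appendTensor_self hρθ hρre c]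
  exact norm_apply_prodBumps_le hρ hB fun i j hij => (hη.trans (sep_append_reflect hη0 h0 hsep i j hij))

end Summit.QuantumFields.YangMills.Theorems.OSLegsAtWeakCouplingC.Loc

end
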